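import Summits.QuantumFields.BalabanUV.T4Continuum.Support.ShellMeasureScaling
import Literature.MathematicalPhysics.QuantumFieldTheory.Balaban1983to89.T4ShellMeasurePolar
import Literature.MathematicalPhysics.QuantumFieldTheory.Balaban1983to89.T4TreeGaugeFixing

/-!
# `T4Continuum.ShellMeasureScalingLocal` — the scaling engine in H-form (core map), cost-free factors, the
# tree-gauge transport of (M1), and the sizing of (S-ii) for the LOCAL member WITH the exterior's first-order term
# (cell `pub-balaban`, sub-cell `t4`, spine estimate NE7c (node U5b), lineage t4-ne7c-p1 = PROVER seat P1
# «shell-measure route», generation 21; tree target `Summits/QuantumFields/BalabanUV/T4Continuum/Support/`;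
# ADDITIVE — imports three tree modules and modifies nothing; companion `ShellMeasureScalingSU2` instantiates §1–§2
# on the tree's `SU(2)` exponential cube chart)

HONEST FRAMING.  Finite four-torus programme, rung (B)+1 only — NOT infinite volume, NOT a mass gap, NOT the Clay
problem, NOT summit progress; (B), `BetaPertHyp`, (B^μ) are not mentioned because nothing here consumes them.  The
cell wall of NE7c — (M1) `T4ShellMeasure.SlotAntiConcentration` FOR BAŁABAN'S INDUCTIVELY DEFINED EFFECTIVE MEASURES —
is NOT PRINTED in [Balaban 1983–89] (GAPS G-ne7cp1-1), asserted by nobody, and NOT moved by this file.  What this file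
touches is the smooth member's located input list (GAPS G-ne7cp1-21: two pointwise inequalities (S-i)/(S-ii) per slot
at one contraction depth): the form of (S-i) is weakened to what the engine uses, centre-monotone factors are shown to
cost nothing in (S-ii), (M1) is shown invariant under the tree gauge, and the SIZING clause of (S-ii) for the local
member (γ_loc) is CORRECTED.  Every declaration is [folklore] kernel mathematics, 0 sorry, 0 citations.

THE POINTS.
* §1 H-FORM.  `ShellMeasureScaling.slotAntiConcentration_of_rayDecay` asks the multiplicative decay
  `u(e^{−a}x) ≤ e^{−(1−δ)a}·u(x)` of the tested variable at every sub-threshold support point.  On directions along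
  which `u` vanishes or cancels to higher order (gauge directions of a chart centred at a flat configuration, toron
  rays) that is false although harmless: what the engine (`shell_le_of_dilation`) uses is only the CORE MAP «the one
  contraction sends every sub-threshold support point into the core `{u < θ(1−ρ)}`».  `slotAntiConcentration_of_coreMap`
  is the headline in that form, with a free depth `a` and any constant `D` with `(dim E + B_f)·a ≤ D·ρ`
  (`…_of_coreMap_depth`: the scaling depth `a = −log(1−ρ)/(1−δ)` gives back `D = 2(dim E + B_f)/(1−δ)`).
* §2 COST-FREE FACTORS.  A factor of the density that does not decrease towards the chart centre along the
  contraction (`J x ≤ J(e^{−a}x)`: a chart Jacobian maximal at the centre, the indicator of a star-shaped window, a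
  kept co-test) contributes NOTHING to the ray-weight loss `e^{B_f a}` of (S-ii) (`coreLoss_mul_of_centreMonotone`,
  `slotAntiConcentration_of_coreMap_mul`).  The companion module proves that the Haar Jacobian
  `e^{−jac_e} = ∏_b (2π²)⁻¹sinc²|x_b|` and the cube window of the tree's `SU(2)` exponential chart ARE such factors.
* §3 TREE GAUGE.  For a gauge-invariant density `F` and a gauge-invariant tested variable `u`, (M1) for the realized
  law is EQUIVALENT to (M1) for the pair precomposed with the tree-gauge map `U ↦ U[T := U₀]` of
  `T4TreeGaugeFixing` (`T` loop-free): `slotAntiConcentration_gaugeFixed_iff`.  This is the kernel form of the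
  dictionary line «axial gauge on a spanning tree of the localization cube» of (γ_loc) (`T4ShellMeasureLocal`): the
  window factorisation of the realized chain (`T4ShellMeasureDet.slotAntiConcentration_realized_local`, hypothesis
  `hFw`) is to be asked of `F ∘ fixTo T U₀` — whose block sections vanish off a cube window of radius `O(R_j ε_j)` by
  the chained axial estimate (located reading (LR); `T4AxialChain`) — since a gauge-INVARIANT `F` never vanishes off a
  proper window of the block.
* §4 THE SIZING OF (S-ii) FOR THE LOCAL MEMBER — CORRECTION of the clause «B_f = 0 when the block action is radially
  non-decreasing from its minimum (criterion (i)), B_f = C·x₀³ by criterion (ii)» of G-ne7cp1-21 (inherited from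
  G-ne7cp1-10b, written for the GLOBAL members, whose dilation centre is the global minimum of the action).  For
  (γ_loc) the exterior is FROZEN and the chart centre (block flat, exterior as it is) is NOT a critical point of the
  sectioned action: the plaquettes across the block's boundary and the exterior-dependence of the effective action
  give a FIRST-ORDER term.  The applicable criterion is (ii′) `fwdLogLipschitzOn_rayWeight_of_deriv_ge_affine`:
  `S′(z) ≥ −(ℓ + C z^m)` on `(0, x₀]` ⇒ `B_f = (ℓ + C x₀^m)·x₀`, `ℓ ≥ 0` the block's linear response to the frozen
  exterior (located, NOT PRINTED; by kind `ℓ_j ≲ g_j⁻²·ε_j·(boundary factor)` and `x₀ ≲ c₀R_jε_j`, so `B_{f,j}` is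
  polylogarithmic in `log g_j⁻²` — K-uniform, NOT `o(1)`; the level sum absorbs polynomial growth in `j` by
  `T4ShellMeasureAnalytic.exists_pow_mul_pow_le`); `rayLoss_of_fwdLogLipschitzOn` is the one-depth form the engine's
  `hden` consumes.  §5 certifies on the sectioned nearest-neighbour toy `S_ζ(x) = (x − ζ)² + x²` (one block variable
  `x`, frozen neighbour `ζ > 0`, flat neighbour `0`) that criterion (i) is UNAVAILABLE — the weight `e^{−S_ζ}` strictly
  DECREASES towards the centre from `ζ/4` (`sectionedToy_not_centreMonotone`) — while (ii′) gives `B_f = 2ζ·x₀`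
  (`sectionedToy_fwdLogLipschitz`, `sectionedToy_rayLoss`).

WHAT THIS DOES NOT DO.  No instance of (S-i)/(S-ii) for Bałaban's localized minimisers / block weights is constructed;
(Det), (FI-sat), (LR), (MR), (W1), the (F∞)-rate keep their status; the linear response `ℓ_j` is a located quantity,
not a printed one.  NE7c NOT proved.
-/

namespace Summit.QuantumFields.BalabanUV.T4Continuum.ShellMeasureScalingLocal

open MeasureTheory Set Function
open scoped ENNReal
open Literature.MathematicalPhysics.QuantumFieldTheory.Balaban1983to89
open T4ShellMeasure (SlotAntiConcentration)
open T4ShellMeasureAnalytic (FwdLogLipschitzOn)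
open ShellMeasureScaling (shell_le_of_dilation)

/-! ## §1 The engine in H-form: one contraction maps the sub-threshold support into the core -/

section Engine

variable {E : Type*} [NormedAddCommGroup E] [NormedSpace ℝ E] [MeasurableSpace E] [BorelSpace E]
  [FiniteDimensional ℝ E] (μ : Measure E) [μ.IsAddHaarMeasure]

/-- **(M1) FROM THE CORE MAP — H-FORM HEADLINE.**  Density model `ν = μ.withDensity f` on a finite-dimensional real
space with additive Haar measure `μ`, finite sub-threshold mass; tested variable `u` measurable; `θ, ρ ≥ 0`; ONE
contraction depth `a`.  HYPOTHESES, pointwise, on the support and below the threshold only: (S-i, core map)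
`u(e^{−a}x) < θ(1−ρ)`; (S-ii, ray-weight loss) `f(x) ≤ e^{B_f a}·f(e^{−a}x)`.  CONCLUSION:
`SlotAntiConcentration ν u θ ρ D` for every `D` with `(dim E + B_f)·a ≤ D·ρ`.  No rate `δ`, no multiplicative decay of
`u` (directions on which `u` cancels need only stay in the core), no window. [folklore] -/
theorem slotAntiConcentration_of_coreMap {f : E → ℝ≥0∞} {u : E → ℝ} (hu : Measurable u)
    {θ ρ a Bf D : ℝ} (hθ : 0 ≤ θ) (hρ : 0 ≤ ρ) (hfin : (μ.withDensity f) {x | u x < θ} ≠ ∞)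
    (hcore : ∀ x, u x < θ → f x ≠ 0 → u (Real.exp (-a) • x) < θ * (1 - ρ))
    (hden : ∀ x, u x < θ → f x ≠ 0 → f x ≤ ENNReal.ofReal (Real.exp (Bf * a)) * f (Real.exp (-a) • x))
    (haD : (Module.finrank ℝ E + Bf) * a ≤ D * ρ) :
    SlotAntiConcentration (μ.withDensity f) u θ ρ D := by
  have hlo : θ * (1 - ρ) ≤ θ := by nlinarith
  have h := shell_le_of_dilation μ hu hlo hfin fun x hx hfx => ⟨hcore x hx hfx, hden x hx hfx⟩
  unfold SlotAntiConcentration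
  refine h.trans ?_
  calc ENNReal.ofReal ((Module.finrank ℝ E + Bf) * a) * (μ.withDensity f) {x | u x < θ}
      ≤ ENNReal.ofReal ((Module.finrank ℝ E + Bf) * a) * (μ.withDensity f) univ :=
        mul_le_mul_right (measure_mono (subset_univ _)) _
    _ ≤ ENNReal.ofReal (D * ρ) * (μ.withDensity f) univ :=
        mul_le_mul_of_nonneg_right (ENNReal.ofReal_le_ofReal haD) bot_le

/-- The H-form at the SCALING DEPTH `a = −log(1−ρ)/(1−δ)` (`δ < 1`, `0 ≤ ρ ≤ 1/2`, `B_f ≥ 0`): the constant of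
`ShellMeasureScaling.slotAntiConcentration_of_rayDecay`, `D = 2(dim E + B_f)/(1−δ)`, from the core map instead of the
multiplicative decay. [folklore] -/
theorem slotAntiConcentration_of_coreMap_depth {f : E → ℝ≥0∞} [IsFiniteMeasure (μ.withDensity f)]
    {u : E → ℝ} (hu : Measurable u) {δ Bf θ ρ : ℝ} (hδ : δ < 1) (hBf : 0 ≤ Bf) (hθ : 0 ≤ θ) (hρ0 : 0 ≤ ρ)
    (hρ2 : ρ ≤ 1 / 2)
    (hcore : ∀ x, u x < θ → f x ≠ 0 →
      u (Real.exp (-(-Real.log (1 - ρ) / (1 - δ))) • x) < θ * (1 - ρ))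
    (hden : ∀ x, u x < θ → f x ≠ 0 →
      f x ≤ ENNReal.ofReal (Real.exp (Bf * (-Real.log (1 - ρ) / (1 - δ)))) *
        f (Real.exp (-(-Real.log (1 - ρ) / (1 - δ))) • x)) :
    SlotAntiConcentration (μ.withDensity f) u θ ρ (2 * (Module.finrank ℝ E + Bf) / (1 - δ)) := by
  have h1δ : 0 < 1 - δ := by linarith
  refine slotAntiConcentration_of_coreMap μ hu hθ hρ0 (measure_ne_top _ _) hcore hden ?_
  have hn : (0 : ℝ) ≤ Module.finrank ℝ E + Bf := by positivity
  have hℓ : -Real.log (1 - ρ) ≤ 2 * ρ := T4ShellMeasureFibre.neg_log_one_sub_le hρ0 hρ2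
  calc (Module.finrank ℝ E + Bf) * (-Real.log (1 - ρ) / (1 - δ))
      = (Module.finrank ℝ E + Bf) / (1 - δ) * (-Real.log (1 - ρ)) := by field_simp
    _ ≤ (Module.finrank ℝ E + Bf) / (1 - δ) * (2 * ρ) := mul_le_mul_of_nonneg_left hℓ (div_nonneg hn h1δ.le)
    _ = 2 * (Module.finrank ℝ E + Bf) / (1 - δ) * ρ := by ring

/-! ## §2 Cost-free factors: a factor that does not decrease towards the centre rides free in (S-ii) -/

omit [NormedAddCommGroup E] [NormedSpace ℝ E] [MeasurableSpace E] [BorelSpace E] [FiniteDimensional ℝ E] in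
/-- pointwise: if `J x ≤ J x'` then a ray-weight loss `M` for `g` between `x` and `x'` is a ray-weight loss `M` for
`J·g`. [folklore] -/
theorem coreLoss_mul_of_centreMonotone {J g : E → ℝ≥0∞} {x x' : E} {M : ℝ≥0∞} (hJ : J x ≤ J x')
    (hg : g x ≤ M * g x') : J x * g x ≤ M * (J x' * g x') := by
  calc J x * g x ≤ J x' * (M * g x') := mul_le_mul' hJ hg
    _ = M * (J x' * g x') := by ring

/-- **(M1) FROM THE CORE MAP, A CENTRE-MONOTONE FACTOR RIDING FREE.**  Density `J·g` where `J` does not decrease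
towards the centre along the contraction (`J x ≤ J(e^{−a}x)`: a chart Jacobian maximal at the centre, the indicator of
a star-shaped window, a kept co-test); (S-i)/(S-ii) are asked of `g` only, on `{J ≠ 0} ∩ {g ≠ 0} ∩ {u < θ}`, and the
ray-weight constant of `J·g` is that of `g`. [folklore] -/
theorem slotAntiConcentration_of_coreMap_mul {J g : E → ℝ≥0∞} {u : E → ℝ} (hu : Measurable u)
    {θ ρ a Bf D : ℝ} (hθ : 0 ≤ θ) (hρ : 0 ≤ ρ)
    (hfin : (μ.withDensity fun x => J x * g x) {x | u x < θ} ≠ ∞)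
    (hJ : ∀ x, J x ≤ J (Real.exp (-a) • x))
    (hcore : ∀ x, u x < θ → J x ≠ 0 → g x ≠ 0 → u (Real.exp (-a) • x) < θ * (1 - ρ))
    (hden : ∀ x, u x < θ → J x ≠ 0 → g x ≠ 0 →
      g x ≤ ENNReal.ofReal (Real.exp (Bf * a)) * g (Real.exp (-a) • x))
    (haD : (Module.finrank ℝ E + Bf) * a ≤ D * ρ) :
    SlotAntiConcentration (μ.withDensity fun x => J x * g x) u θ ρ D := by
  refine slotAntiConcentration_of_coreMap μ hu hθ hρ hfin (fun x hx hfx => ?_) (fun x hx hfx => ?_) haD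
  · exact hcore x hx (left_ne_zero_of_mul hfx) (right_ne_zero_of_mul hfx)
  · exact coreLoss_mul_of_centreMonotone (hJ x)
      (hden x hx (left_ne_zero_of_mul hfx) (right_ne_zero_of_mul hfx))

end Engine

/-! ## §3 Tree gauge: (M1) for a gauge-invariant pair is invariant under `U ↦ U[T := U₀]` -/

section Gauge

open GaugeField (gaugeAct GaugeInvariant)
open T4TreeGaugeFixing (NoClosedLoop fixTo measurable_fixTo lintegral_eq_lintegral_fixTo_of_noClosedLoop)

variable {P : Params} {j : ℕ} {G : Type*} [GaugeGroup G] [MeasurableSpace G] [HaarData G] [MeasurableMul G]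
  [DecidableEq (PBond P j)]

/-- the mass of a level set of a gauge-invariant variable under a gauge-invariant density is unchanged by the
tree-gauge substitution `U ↦ U[T := U₀]` (`T` loop-free): `T4TreeGaugeFixing.lintegral_eq_lintegral_fixTo_of_noClosedLoop`
applied to `1_{u ∈ I}·F`. [folklore] -/
theorem withDensity_preimage_eq_fixTo {T : Finset (PBond P j)} (hT : NoClosedLoop T) (U₀ : GaugeField P j G)
    {F : GaugeField P j G → ℝ≥0∞} (hF : Measurable F) (hFi : GaugeInvariant F)
    {u : GaugeField P j G → ℝ} (hu : Measurable u) (hui : GaugeInvariant u) {I : Set ℝ} (hI : MeasurableSet I) :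
    ((fieldMeasure P j G).withDensity F) (u ⁻¹' I) =
      ((fieldMeasure P j G).withDensity (F ∘ fixTo T U₀)) ((u ∘ fixTo T U₀) ⁻¹' I) := by
  have hm : MeasurableSet (u ⁻¹' I) := hu hI
  have hm' : MeasurableSet ((u ∘ fixTo T U₀) ⁻¹' I) := (hu.comp (measurable_fixTo T U₀)) hI
  rw [withDensity_apply _ hm, withDensity_apply _ hm', ← lintegral_indicator hm, ← lintegral_indicator hm']
  have hG : Measurable ((u ⁻¹' I).indicator F) := hF.indicator hm
  have hGi : GaugeInvariant ((u ⁻¹' I).indicator F) := by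
    intro g U
    have hmem : gaugeAct g U ∈ u ⁻¹' I ↔ U ∈ u ⁻¹' I := by rw [mem_preimage, mem_preimage, hui g U]
    by_cases hU : U ∈ u ⁻¹' I
    · rw [indicator_of_mem hU, indicator_of_mem (hmem.2 hU), hFi g U]
    · rw [indicator_of_notMem hU, indicator_of_notMem (mt hmem.1 hU)]
  rw [lintegral_eq_lintegral_fixTo_of_noClosedLoop hT U₀ hG hGi]
  rfl

/-- **(M1) TRANSPORTS THROUGH THE TREE GAUGE.**  For a loop-free bond set `T`, any prescribed values `U₀`, a
gauge-invariant measurable density `F` and a gauge-invariant measurable tested variable `u`: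
(M1) for `((dU).withDensity (F ∘ fixTo T U₀), u ∘ fixTo T U₀)` ⇔ (M1) for `((dU).withDensity F, u)`, same constants.
[folklore] -/
theorem slotAntiConcentration_gaugeFixed_iff {T : Finset (PBond P j)} (hT : NoClosedLoop T) (U₀ : GaugeField P j G)
    {F : GaugeField P j G → ℝ≥0∞} (hF : Measurable F) (hFi : GaugeInvariant F)
    {u : GaugeField P j G → ℝ} (hu : Measurable u) (hui : GaugeInvariant u) {θ ρ D : ℝ} :
    SlotAntiConcentration ((fieldMeasure P j G).withDensity (F ∘ fixTo T U₀)) (u ∘ fixTo T U₀) θ ρ D ↔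
      SlotAntiConcentration ((fieldMeasure P j G).withDensity F) u θ ρ D := by
  have h1 := withDensity_preimage_eq_fixTo hT U₀ hF hFi hu hui
    (measurableSet_Ico : MeasurableSet (Ico (θ * (1 - ρ)) θ))
  have h2 := withDensity_preimage_eq_fixTo hT U₀ hF hFi hu hui MeasurableSet.univ
  unfold SlotAntiConcentration
  change ((fieldMeasure P j G).withDensity (F ∘ fixTo T U₀)) ((u ∘ fixTo T U₀) ⁻¹' Ico (θ * (1 - ρ)) θ) ≤
      ENNReal.ofReal (D * ρ) * ((fieldMeasure P j G).withDensity (F ∘ fixTo T U₀)) ((u ∘ fixTo T U₀) ⁻¹' univ) ↔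
    ((fieldMeasure P j G).withDensity F) (u ⁻¹' Ico (θ * (1 - ρ)) θ) ≤
      ENNReal.ofReal (D * ρ) * ((fieldMeasure P j G).withDensity F) (u ⁻¹' univ)
  rw [h1, h2]

end Gauge

/-! ## §4 The sizing of (S-ii) for the LOCAL member: the first-order (exterior) term -/

section Sizing

open T4ShellMeasurePolar (fwdLogLipschitzOn_rayWeight_of_deriv_ge)

/-- **CRITERION (ii′) — RAY ACTIONS WITH A FIRST-ORDER TERM AT THE CHART CENTRE.**  If the sectioned block action
along the ray is differentiable on `(0, x₀]` with `S′(z) ≥ −(ℓ + C z^m)` (`ℓ, C ≥ 0`: `ℓ` the linear response to the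
frozen exterior, `C z^m` the remainder), the Boltzmann ray weight `r ↦ e^{−S(e^{−r})}` is forward log-Lipschitz with
constant `B_f = (ℓ + C·x₀^m)·x₀` on every `W ⊆ [−log x₀, ∞)`.  (`T4ShellMeasurePolar`'s criterion (ii) with exponent
`0` and constant `ℓ + C x₀^m`; criterion (i) `B_f = 0` needs `ℓ = 0`, which the frozen exterior forbids — §5.)
[folklore] -/
theorem fwdLogLipschitzOn_rayWeight_of_deriv_ge_affine {S S' : ℝ → ℝ} {ℓ C x₀ : ℝ} {m : ℕ} (hℓ : 0 ≤ ℓ)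
    (hC : 0 ≤ C) (hx₀ : 0 < x₀) (hS : ∀ z ∈ Ioc 0 x₀, HasDerivAt S (S' z) z)
    (hS' : ∀ z ∈ Ioc 0 x₀, -(ℓ + C * z ^ m) ≤ S' z) {W : Set ℝ} (hW : W ⊆ Ici (-Real.log x₀)) :
    FwdLogLipschitzOn (fun r => ENNReal.ofReal (Real.exp (-S (Real.exp (-r))))) ((ℓ + C * x₀ ^ m) * x₀) W := by
  have h := fwdLogLipschitzOn_rayWeight_of_deriv_ge (S := S) (S' := S') (m := 0) (C := ℓ + C * x₀ ^ m)
    (by positivity) hx₀ hS (fun z hz => ?_) hW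
  · simpa only [zero_add, pow_one] using h
  · have hzm : z ^ m ≤ x₀ ^ m := pow_le_pow_left₀ hz.1.le hz.2 m
    have h1 := hS' z hz
    rw [pow_zero, mul_one]
    nlinarith [mul_le_mul_of_nonneg_left hzm hC]

/-- the one-depth form consumed by the engine's `hden`: a forward log-Lipschitz ray weight on `[−log x₀, ∞)` loses at
most `e^{B_f a}` under the contraction by `e^{−a}`, `a ≥ 0`, from every point `z ∈ (0, x₀]` of the ray. [folklore] -/
theorem rayLoss_of_fwdLogLipschitzOn {w : ℝ → ℝ≥0∞} {Bf x₀ : ℝ}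
    (h : FwdLogLipschitzOn (fun r => w (Real.exp (-r))) Bf (Ici (-Real.log x₀))) {z : ℝ} (hz : z ∈ Ioc 0 x₀)
    {a : ℝ} (ha : 0 ≤ a) : w z ≤ ENNReal.ofReal (Real.exp (Bf * a)) * w (Real.exp (-a) * z) := by
  have hr : -Real.log z ∈ Ici (-Real.log x₀) := by
    rw [mem_Ici, neg_le_neg_iff]; exact Real.log_le_log hz.1 hz.2
  have hr' : -Real.log z + a ∈ Ici (-Real.log x₀) := by
    rw [mem_Ici] at hr ⊢; linarith
  have key := h hr hr' (by linarith)
  have e1 : Real.exp (-(-Real.log z)) = z := by rw [neg_neg, Real.exp_log hz.1]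
  have e2 : Real.exp (-(-Real.log z + a)) = Real.exp (-a) * z := by
    rw [neg_add, Real.exp_add, neg_neg, Real.exp_log hz.1, mul_comm]
  simp only [e1, e2, add_sub_cancel_left] at key
  exact key

end Sizing

/-! ## §5 The sectioned nearest-neighbour toy: criterion (i) is unavailable, (ii′) applies -/

section Toy

/-- THE SECTIONED TOY ACTION `S_ζ(x) = (x − ζ)² + x²`: one block variable `x` coupled quadratically to a FROZEN
exterior value `ζ` and to a flat neighbour `0` — the shape of any nearest-neighbour quadratic form sectioned at a
non-flat exterior; its derivative is `S_ζ′(z) = 4z − 2ζ`, so `S_ζ′(0) = −2ζ ≠ 0` at the chart centre. [folklore] -/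
theorem hasDerivAt_toyAction (ζ z : ℝ) : HasDerivAt (fun x : ℝ => (x - ζ) ^ 2 + x ^ 2) (4 * z - 2 * ζ) z := by
  have h1 : HasDerivAt (fun x : ℝ => (x - ζ) ^ 2) (((2 : ℕ) : ℝ) * (z - ζ) ^ (2 - 1) * 1) z :=
    ((hasDerivAt_id z).sub_const ζ).pow 2
  have h2 : HasDerivAt (fun x : ℝ => x ^ 2) (((2 : ℕ) : ℝ) * z ^ (2 - 1)) z := hasDerivAt_pow 2 z
  have h := h1.add h2
  have e : ((2 : ℕ) : ℝ) * (z - ζ) ^ (2 - 1) * 1 + ((2 : ℕ) : ℝ) * z ^ (2 - 1) = 4 * z - 2 * ζ := by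
    push_cast; ring
  rw [e] at h
  exact h

/-- **CRITERION (i) IS UNAVAILABLE FOR A SECTIONED ACTION.**  With a frozen exterior `ζ > 0` the Boltzmann weight
`e^{−S_ζ}` strictly DECREASES towards the chart centre from the sub-threshold point `ζ/4` under every genuine
contraction `e^{−a}`, `a > 0`: the ray-weight inequality of (S-ii) with `B_f = 0` FAILS there.  (So «B_f = 0 when the
block action is radially non-decreasing from its minimum» is void for the local member: the centre is not the minimum
of the sectioned action.) [folklore] -/
theorem sectionedToy_not_centreMonotone {ζ a : ℝ} (hζ : 0 < ζ) (ha : 0 < a) :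
    ¬ Real.exp (-((ζ / 4 - ζ) ^ 2 + (ζ / 4) ^ 2)) ≤
        Real.exp (0 * a) * Real.exp (-((Real.exp (-a) * (ζ / 4) - ζ) ^ 2 + (Real.exp (-a) * (ζ / 4)) ^ 2)) := by
  rw [zero_mul, Real.exp_zero, one_mul, not_le, Real.exp_lt_exp, neg_lt_neg_iff]
  have hc1 : Real.exp (-a) < 1 := by rw [Real.exp_lt_one_iff]; linarith
  have hc0 : 0 < Real.exp (-a) := Real.exp_pos _
  nlinarith [mul_pos hζ hζ, mul_pos (sub_pos.2 hc1) hζ]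

/-- **CRITERION (ii′) APPLIES TO THE TOY**: `S_ζ′(z) = 4z − 2ζ ≥ −2ζ`, so the ray weight `e^{−S_ζ(e^{−r})}` is forward
log-Lipschitz with `B_f = 2ζ·x₀` on `[−log x₀, ∞)` — linear in the exterior amplitude `ζ` and in the reach `x₀`, not
zero and not cubic. [folklore] -/
theorem sectionedToy_fwdLogLipschitz {ζ x₀ : ℝ} (hζ : 0 ≤ ζ) (hx₀ : 0 < x₀) :
    FwdLogLipschitzOn (fun r => ENNReal.ofReal (Real.exp (-((Real.exp (-r) - ζ) ^ 2 + Real.exp (-r) ^ 2))))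
      (2 * ζ * x₀) (Ici (-Real.log x₀)) := by
  have h := fwdLogLipschitzOn_rayWeight_of_deriv_ge_affine (S := fun x : ℝ => (x - ζ) ^ 2 + x ^ 2)
    (S' := fun z => 4 * z - 2 * ζ)
    (ℓ := 2 * ζ) (C := 0) (m := 0) (by positivity) le_rfl hx₀ (fun z _ => hasDerivAt_toyAction ζ z)
    (fun z hz => by rw [zero_mul, add_zero]; linarith [hz.1]) (Subset.refl (Ici (-Real.log x₀)))
  simpa only [zero_mul, add_zero] using h

/-- … hence, at one depth: from every `z ∈ (0, x₀]` the toy weight loses at most `e^{2ζx₀·a}` under `e^{−a}`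
(`rayLoss_of_fwdLogLipschitzOn`) — the `hden` shape of §1 with `B_f = 2ζ·x₀ > 0`. [folklore] -/
theorem sectionedToy_rayLoss {ζ x₀ : ℝ} (hζ : 0 ≤ ζ) (hx₀ : 0 < x₀) {z : ℝ} (hz : z ∈ Ioc 0 x₀) {a : ℝ}
    (ha : 0 ≤ a) :
    ENNReal.ofReal (Real.exp (-((z - ζ) ^ 2 + z ^ 2))) ≤
      ENNReal.ofReal (Real.exp (2 * ζ * x₀ * a)) *
        ENNReal.ofReal (Real.exp (-((Real.exp (-a) * z - ζ) ^ 2 + (Real.exp (-a) * z) ^ 2))) :=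
  rayLoss_of_fwdLogLipschitzOn (w := fun t => ENNReal.ofReal (Real.exp (-((t - ζ) ^ 2 + t ^ 2))))
    (sectionedToy_fwdLogLipschitz hζ hx₀) hz ha

end Toy

end Summit.QuantumFields.BalabanUV.T4Continuum.ShellMeasureScalingLocal
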